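/-
Copyright (c) 2026. All rights reserved.
Released under Apache 2.0 license as described in the file LICENSE.
Authors: abc-iut cell, seat abc-iut-L4-t14 (gen 2; GAP row G-w5d226-1, proof-only companion of file 2: the
RC-holomorphic geometric category IS print's `TH` on Riemann surfaces).
-/
import Literature.AnabelianGeometry.AbsoluteAnabelian.ArchimedeanHolFieldFunctorGeometricRC
import Literature.AnabelianGeometry.AbsoluteAnabelian.AutHolomorphicSpacesLocalProofs
import Literature.AnabelianGeometry.AbsoluteAnabelian.CoorientationsProofs
import Literature.AnabelianGeometry.AbsoluteAnabelian.AbsTopIII.RemarksArchimedeanLocalProofs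
import Literature.AnabelianGeometry.AbsoluteAnabelian.RCHolomorphicInverse
import HarnessLib

/-!
# The morphisms of `HolRS.RC` are EXACTLY the finite étale morphisms of Aut-holomorphic spaces (Def 2.1 (ii))

S. Mochizuki, *Topics in absolute anabelian geometry III*, Def 2.1 (ii) p. 51 (morphisms of Aut-holomorphic
spaces), Cor 2.3 (i) p. 53 (such morphisms are RC-holomorphic), Def 4.1 (iii) p. 103 (`TH ⊇ EA`: "the finite
étale morphisms"); kurims manuscript `paper:url-5493eb38cbb7`; bib key `MochizukiAbsTopIII2015`.
PROOF-ONLY companion (no new notion) of `ArchimedeanHolFieldFunctorGeometricRC.lean` (file 2 of the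
geometric model of abc-iut-L4-t10's interface `AutHolFieldFunctor`).

File 2 DEFINED the morphisms of `HolRS.RC` as the RC-holomorphic finite étale maps of connected Riemann
surfaces and labelled this "the print-faithful widening" of the holomorphic sub-model.  This file PROVES the
label: for connected Hausdorff Riemann surfaces `𝕏`, `𝕐`, a map `φ : 𝕏 → 𝕐` underlies a morphism of
`HolRS.RC` if and only if it is a finite étale morphism of the Aut-holomorphic spaces
`AutHolStructure.ofCharted 𝕏 → AutHolStructure.ofCharted 𝕐` in the sense of Def 2.1 (ii) (abc-iut-L4-t2's
`IsMorphism`: a local homeomorphism transporting `Aut^hol(U)` onto `Aut^hol(V)` along every induced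
homeomorphism of connected opens) — `HolRS.RC.exists_hom_iff`.  So, for Riemann surfaces (trivial
orbi-group), the geometric `EA` of file 2 is LITERALLY the category `TH` of print restricted by the object
property `Q`, not merely a modelling choice.

* `TH ⊆ RC` (`HolRS.RC.exists_hom_of_isMorphism`): by Cor 2.3 (i), now a theorem of the tree —
  abc-iut-L4-t7's `localMorphismIsRCHolomorphic_holds` (F-0074) with `IsMorphism.isRCHolomorphic_of`;
* `RC ⊆ TH` (`HolRS.RCHom.isMorphism`): the holomorphic branch is file 1's `HolRS.Hom.isMorphism`
  (holomorphic inverse function theorem); the anti-holomorphic branch is the transport of `Aut^hol(U)` along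
  an ANTI-holomorphic homeomorphism of opens (`HolRS.holAut_map_homeoConj_of_isAntiHolAt`:
  anti ∘ hol ∘ anti = hol by abc-iut-L4-t8's parities), the restriction being anti-holomorphic by
  abc-iut-L4-t8's `IsAntiHolAt.restrict_opens` and its inverse by abc-iut-L4-t8's `IsAntiHolAt.symm_apply`.

Refereed pre-IUT anabelian geometry; nothing here bears on [IUTchIII] Cor. 3.12 or takes a side; the ORBI
case (`Γ ≠ 1`) and the Cor 2.7 algorithms remain outside (MODELLING CHOICES (b), (d) of file 1).
-/

set_option autoImplicit false

noncomputable section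

namespace Literature.AnabelianGeometry.AbsoluteAnabelian

open _root_.CategoryTheory _root_.Topology _root_.TopologicalSpace _root_.Set
open scoped _root_.Manifold _root_.ContDiff

namespace HolRS

/-! ### `TH ⊆ RC`: a finite étale morphism of Aut-holomorphic spaces is a morphism of `HolRS.RC` -/

/-- **Every finite étale morphism of the Aut-holomorphic spaces of two connected Riemann surfaces underlies
a morphism of `HolRS.RC`** (it is RC-holomorphic by Cor 2.3 (i) = `localMorphismIsRCHolomorphic_holds`).
[cite: MochizukiAbsTopIII2015, Corollary 2.3 (i) p.53] -/
theorem RC.exists_hom_of_isMorphism {X Y : HolRS} {φ : X.carrier → Y.carrier}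
    (hφ : IsMorphism (AutHolStructure.ofCharted X.carrier) (AutHolStructure.ofCharted Y.carrier) φ)
    (hfe : IsFiniteEtale φ) : ∃ f : (RC.mk X) ⟶ (RC.mk Y), f.toFun = φ :=
  ⟨⟨φ, hφ.isRCHolomorphic_of localMorphismIsRCHolomorphic_holds, hfe⟩, rfl⟩

/-! ### `RC ⊆ TH`: transport of `Aut^hol` along an anti-holomorphic homeomorphism of opens -/

section AntiTransport

variable {M : Type} [TopologicalSpace M] [ChartedSpace ℂ M] {N : Type} [TopologicalSpace N] [ChartedSpace ℂ N]

/-- Conjugating a holomorphic self-map of `U` by an ANTI-holomorphic homeomorphism `e : U ≃ₜ V` (with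
anti-holomorphic inverse) gives a holomorphic self-map of `V`: anti ∘ hol ∘ anti = hol, pointwise, by
abc-iut-L4-t8's parities. [cite: MochizukiAbsTopIII2015, Definition 2.1 (ii) p.51] -/
theorem mdifferentiable_conj_of_isAntiHolAt {U : Opens M} {V : Opens N} (e : U ≃ₜ V)
    (he : ∀ x : U, IsAntiHolAt e x) (he' : ∀ y : V, IsAntiHolAt e.symm y) {ψ : U → U}
    (hψ : MDifferentiable 𝓘(ℂ, ℂ) 𝓘(ℂ, ℂ) ψ) : MDifferentiable 𝓘(ℂ, ℂ) 𝓘(ℂ, ℂ) (e ∘ ψ ∘ e.symm) := by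
  intro y
  have h1 : IsAntiHolAt (ψ ∘ e.symm) y :=
    IsHolAt.comp_isAntiHolAt (Filter.Eventually.of_forall fun z => hψ z) (he' y)
  have h2 : IsHolAt (e ∘ (ψ ∘ e.symm)) y := IsAntiHolAt.comp_isAntiHolAt (he _) h1
  exact h2.mdifferentiableAt

omit [ChartedSpace ℂ M] [ChartedSpace ℂ N] in
/-- Conjugation identities for `homeoConj` (underlying maps). [cite: MochizukiAbsTopIII2015, Definition 2.1 (ii) p.51] -/
theorem coe_homeoConj_symm_apply {U : Opens M} {V : Opens N} (e : U ≃ₜ V) (χ : V ≃ₜ V) :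
    (⇑((homeoConj e).symm χ) = e.symm ∘ χ ∘ e) ∧ (⇑((homeoConj e).symm χ).symm = e.symm ∘ χ.symm ∘ e) ∧
      (⇑χ = e ∘ ((homeoConj e).symm χ) ∘ e.symm) ∧ (⇑χ.symm = e ∘ ((homeoConj e).symm χ).symm ∘ e.symm) := by
  refine ⟨?_, ?_, ?_, ?_⟩ <;> ext y <;> simp [homeoConj]

/-- **Transport of `Aut^hol` along an anti-holomorphic homeomorphism of opens**: if `e : U ≃ₜ V` and
`e⁻¹` are anti-holomorphic at every point, conjugation by `e` carries `Aut^hol(U)` onto `Aut^hol(V)` (the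
anti-holomorphic twin of file 1's `holAut_map_homeoConj_of_mdifferentiable`).
[cite: MochizukiAbsTopIII2015, Definition 2.1 (ii) p.51] -/
theorem holAut_map_homeoConj_of_isAntiHolAt {U : Opens M} {V : Opens N} (e : U ≃ₜ V)
    (he : ∀ x : U, IsAntiHolAt e x) (he' : ∀ y : V, IsAntiHolAt e.symm y) :
    (holAut U).map (homeoConj e).toMonoidHom = holAut V := by
  ext χ
  rw [Subgroup.mem_map_equiv]
  simp only [mem_holAut_iff]
  obtain ⟨c1, c2, c3, c4⟩ := coe_homeoConj_symm_apply e χ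
  have hsymm : ∀ x : U, IsAntiHolAt e.symm.symm x := fun x => by simpa using he x
  constructor
  · rintro ⟨h1, h2⟩
    refine ⟨?_, ?_⟩
    · rw [c3]; exact mdifferentiable_conj_of_isAntiHolAt e he he' h1
    · rw [c4]; exact mdifferentiable_conj_of_isAntiHolAt e he he' h2
  · rintro ⟨h1, h2⟩
    refine ⟨?_, ?_⟩
    · rw [c1]
      exact mdifferentiable_conj_of_isAntiHolAt e.symm he' hsymm h1
    · rw [c2]
      exact mdifferentiable_conj_of_isAntiHolAt e.symm he' hsymm h2

end AntiTransport

/-- **Every morphism of `HolRS.RC` is a morphism of Aut-holomorphic spaces** (Def 2.1 (ii)): a local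
homeomorphism which transports `Aut^hol(U)` onto `Aut^hol(V)` along every induced homeomorphism of connected
opens — the holomorphic branch by file 1's `Hom.isMorphism`, the anti-holomorphic branch by
`holAut_map_homeoConj_of_isAntiHolAt`. [cite: MochizukiAbsTopIII2015, Definition 2.1 (ii) p.51] -/
theorem RCHom.isMorphism {X Y : HolRS} (f : RCHom X Y) :
    IsMorphism (AutHolStructure.ofCharted X.carrier) (AutHolStructure.ofCharted Y.carrier) f.toFun := by
  rcases f.isHol_or_isAntiHol with h | h
  · have hm : MDifferentiable 𝓘(ℂ, ℂ) 𝓘(ℂ, ℂ) f.toFun := fun x => (h x).mdifferentiableAt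
    exact Hom.isMorphism (⟨f.toFun, hm, f.isFiniteEtale⟩ : X ⟶ Y)
  · refine ⟨f.isFiniteEtale.isCoveringMap.isLocalHomeomorph, ?_⟩
    intro U V _ _ e he
    rw [AutHolStructure.ofCharted_aut, AutHolStructure.ofCharted_aut]
    have hea : ∀ x : U.1, IsAntiHolAt e x := fun x => IsAntiHolAt.restrict_opens he (h x)
    have hea' : ∀ y : V.1, IsAntiHolAt e.symm y := fun y => by
      simpa using (hea (e.symm y)).symm_apply e
    exact holAut_map_homeoConj_of_isAntiHolAt e hea hea'

/-- **The morphisms of `HolRS.RC` are exactly the finite étale morphisms of Aut-holomorphic spaces**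
between connected Hausdorff Riemann surfaces: for Riemann surfaces the geometric category of file 2 IS
print's `TH` (Def 2.1 (ii) morphisms, finite étale, Def 4.1 (iii)).
[cite: MochizukiAbsTopIII2015, Definition 4.1 (iii) p.103] -/
theorem RC.exists_hom_iff {X Y : HolRS} (φ : X.carrier → Y.carrier) :
    (∃ f : (RC.mk X) ⟶ (RC.mk Y), f.toFun = φ) ↔
      IsMorphism (AutHolStructure.ofCharted X.carrier) (AutHolStructure.ofCharted Y.carrier) φ ∧
        IsFiniteEtale φ := by
  constructor
  · rintro ⟨f, rfl⟩
    exact ⟨RCHom.isMorphism f, f.isFiniteEtale⟩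
  · rintro ⟨hφ, hfe⟩
    exact RC.exists_hom_of_isMorphism hφ hfe

/-- In particular the objects of the geometric `EA` of file 2 over any `Q`, with their `RC`-automorphisms,
are Aut-holomorphic spaces with (some of) their finite étale self-morphisms: every `RC`-endomorphism of `𝕏`
is an `IsMorphism` of `AutHolStructure.ofCharted 𝕏`. [cite: MochizukiAbsTopIII2015, Definition 4.1 (iii) p.103] -/
theorem RC.isMorphism_of_hom (Q : ObjectProperty RC) {X Y : (geometricAutHolFieldFunctorRC Q).EA}
    (f : X ⟶ Y) :
    IsMorphism (AutHolStructure.ofCharted X.obj.of.carrier) (AutHolStructure.ofCharted Y.obj.of.carrier)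
      f.hom.toFun :=
  RCHom.isMorphism f.hom

end HolRS

end Literature.AnabelianGeometry.AbsoluteAnabelian

end
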